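import Summits.QuantumFields.BalabanUV.Beta.GAN24.DiagramVolumeLimitPairs

/-!
# `BalabanUV.Beta.GAN24.DiagramVolumeLimitSandwich` — binder row G-an2-4 ∕ (CONV-C), route R7 «TWO CURRENCIES», PART 143: THE GENERIC SANDWICH `S·D·S′` ON `ℤ^d` AND THE u-DERIVATIVE SHAPE
# `c_k⁻¹·X·c_k⁻¹` MODULO THE INSERTION.  §1 makes PART 142 §5 generic in all three factors: three volume-indexed towers `S_t k, D_t k, S′_t k` on the unit index sets of the cubic tori with
# (UD)+(SR) in `distK` at a common rate (constants free of `t, k`) and pair entry limits (EL₂) give the β-cell's whole `LimitRate` END for `S_t k·D_t k·S′_t k` (`d ≥ 2` for PART 127's letter,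
# any `side t → ∞`, `μ ≠ ν`).  §2 verifies the three inputs for `c_k⁻¹ = Σ_k + a·1` (the INVERSE averaged covariance, from the effective form's: PART 132 ∕ 140 ∕ 142 plus the unit kernel),
# §3 concludes: for ANY insertion tower `X_t k` with (UD)+(SR)+EL₂ the u-derivative-shaped tower `c_k⁻¹·X_t k·c_k⁻¹` (PART 128's `Σ̇ = −c⁻¹ċc⁻¹` up to sign, PART 129's perturbed objects) has the END
# on `ℤ^d` (`d ≥ 3`, `L ≥ 2`, `a > 0`, `μ ≠ ν`, even cubic volumes) — the insertion `X` (= the averaged fine-level `ċ_k`) is the ONLY displayed input (unit b2b-balaban-gan24-p3, gen 54; v1)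

NOT IN PRINT; OUR PROOF ([folklore] bookkeeping BY NAME over PART 142 (`tendsto_mul_entry_pair`, `tendsto_mul_entry_pair'`, `norm_le_exp_window_of_entryDecay`, `effForm_pair_bounds`), PART 140
(`conv_of_decay_of_tendsto`, `tendsto_effForm_entry`, `tendsto_one_apply_castT`), PART 137 (`shiftInv_one`), PART 132 (`decay_effForm`), PART 130 (`entryDecay_mul_tower`, `twoLevelDecayRate_mul`,
`entryDecay_add`), PART 128 (`entryDecay_of_le_rate`), PART 127 (`sum_exp_distK_le`, `entryDecay_smul`, `entryDecay_one`, `distK_self`); [Balaban1987RG1] (1.21)–(1.22) p. 264 LOCATE the shapes;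
nothing printed is a hypothesis).
HONEST FRAMING (cell contract, verbatim): «discharging `BetaPertH` makes Bałaban's UV stability UNCONDITIONAL — a real constructive-QFT result; it is NOT the
continuum limit and NOT the Clay problem.»  HONEST DEPENDENCY (verbatim): «continuum YM on T⁴ ⇐ BetaPertH ∧ nine spine estimates (0/9 proved); BetaPertH ⇐
(D1) ∧ (D4) ∧ CAP+tail; G-an2-4 gates asym, D1 and NE2/3/4.»

WHAT THIS FILE PROVES (0 sorry, 0 `def`; `e = (unitIdx L (cubic d s))⁻¹`, `ẑ` the reading of `z ∈ ℤ^d`; EL₂(X_t) ≡ `∀ μ ν z z′, ∃ s, X_t(e(ẑ,μ), e(ẑ′,ν)) → s`):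
* §1 `norm_le_of_entryDecay` ((UD) ⟹ the volume-uniform bound), **`conv_sandwich_of_decay_of_tendsto`** — THE GENERIC SANDWICH: (UD) `(B_S, κ)`, `(B_D, κ)`, `(B_S′, κ)` and (SR) `(B_S′′…, κ, θ)` for the
  three towers, EL₂ of the three ⟹ `∃ Π`, `IsInfiniteVolumeLimit side (Re (S D S′)(e(·,μ′),e(0,ν′))) (Π k)`, `UniformDecay Π μ ν B (κ∕4∕d)`, `StepRate Π μ ν B′ (κ∕4∕d) θ`, `KernelInputs d Π`,
  `|secondMoment (Π k) μ ν − secondMoment Π_∞ μ ν| ≤ β′_d(B′∕(1−θ), κ∕4∕d)·θ^k`, with `B, B′` explicit in the inputs and PART 127's letter.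
* §2 `invCov_eq_effForm_add` (`c_k⁻¹ = Σ_k + a·1`), `tendsto_one_pair` (EL₂ of the unit kernel), **`invCov_inputs`** (`L ≥ 2`, `d ≥ 3`: `∃ κ > 0, B, B′ ≥ 0` with (UD)+(SR) of `k ↦ c_k⁻¹` on every cubic
  torus and EL₂ along the even cubic volumes).
* §3 **`conv_insertion_invCov_of_kernel`** — THE u-DERIVATIVE SOCKET: `X_t k` with (UD) `(B_X, κ_X)`, (SR) `(B_X′, κ_X, √(L⁻¹))`, EL₂ ⟹ the END for `c_k⁻¹·X_t k·c_k⁻¹` along `side t = 2(t+1)`.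
WHAT IT DOES NOT DO: supply `ċ_k` (the fine-level averaged insertion `L^{dk}Q_k𝒢P𝒢Q_kᴴ`: its EL₂ needs the fine-torus twin of PART 142 §3 and a volume-limit hypothesis on the background);
`d ≤ 2`; odd volumes for §2–§3.  SUPPLIER work; NEVER «G-an2-4 closed»; NOT (CONV-C), NOT D1, NOT `BetaPertH`, NOT continuum, NOT Clay.  Records: `HOME/b2b-balaban-gan24-p3/gen54/README.md`.
-/

noncomputable section

open scoped BigOperators ComplexConjugate Matrix Matrix.Norms.L2Operator
open Filter Topology

namespace Summit.QuantumFields.BalabanUV.Beta.GAN24.DiagramVolumeLimitSandwich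

open Literature.MathematicalPhysics.QuantumFieldTheory.Balaban1983to89
open Literature.MathematicalPhysics.QuantumFieldTheory.Balaban1983to89.B5Prop11Plancherel (Tor fine)
open Literature.MathematicalPhysics.QuantumFieldTheory.Balaban1983to89.B12Sec2to5 (l1 betaPrime510)
open Literature.MathematicalPhysics.QuantumFieldTheory.Balaban1983to89.Beta (Site windowMap IsInfiniteVolumeLimit)
open Literature.MathematicalPhysics.QuantumFieldTheory.Balaban1983to89.Beta.FreeLegDictionary (cubic)
open Literature.MathematicalPhysics.QuantumFieldTheory.Balaban1983to89.Beta.BlockKernelVolumeSockets (evenPeriod tendsto_evenPeriod)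
open Literature.MathematicalPhysics.QuantumFieldTheory.Balaban1983to89.Beta.VectorTails (castT castT_add castT_neg)
open Literature.MathematicalPhysics.QuantumFieldTheory.Balaban1983to89.Beta.LimitRate (StepRate limKernelOf KernelInputs)
open Summit.QuantumFields.BalabanUV.T4Continuum
open Summit.QuantumFields.BalabanUV.T4Continuum.BalabanAveragedTowerUnit (idx unitCovB)
open Summit.QuantumFields.BalabanUV.T4Continuum.BalabanAveragedCoerciveTower (unitIdx)
open Summit.QuantumFields.BalabanUV.T4Continuum.CTKingTowerWeights (distK)
open Summit.QuantumFields.BalabanUV.T4Continuum.DecayRateInterpolation (EntryDecay TwoLevelDecayRate)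
open Summit.QuantumFields.BalabanUV.Beta.GAN24.DiagramDecayAlgebra (twoLevelDecayRate_mul entryDecay_mul_tower entryDecay_add)
open Summit.QuantumFields.BalabanUV.Beta.GAN24.UnitLatticeDecayAlgebra (sum_exp_distK_le distK_nonneg distK_triangle distK_self entryDecay_smul entryDecay_one)
open Summit.QuantumFields.BalabanUV.Beta.GAN24.EffectiveFormDecay (entryDecay_of_le_rate)
open Summit.QuantumFields.BalabanUV.Beta.GAN24.DiagramDecayTorus (decay_effForm)
open Summit.QuantumFields.BalabanUV.Beta.GAN24.VolumeLimitInverse (shiftInv_one)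
open Summit.QuantumFields.BalabanUV.Beta.GAN24.DiagramVolumeLimit (conv_of_decay_of_tendsto tendsto_effForm_entry tendsto_one_apply_castT)
open Summit.QuantumFields.BalabanUV.Beta.GAN24.DiagramVolumeLimitPairs (tendsto_mul_entry_pair tendsto_mul_entry_pair' norm_le_exp_window_of_entryDecay effForm_pair_bounds)

variable {d : ℕ} (L : ℕ) [NeZero L]

/-! ## §1 The generic sandwich `S·D·S′` -/

section Generic

variable {side : ℕ → ℕ} [∀ t, NeZero (side t)]

omit [NeZero L] in
/-- (UD) in `distK` ⟹ the volume-uniform bound `‖X(e(x,μ), e(y,ν))‖ ≤ B` (for `κ ≥ 0`). [folklore] -/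
theorem norm_le_of_entryDecay (s : ℕ) [NeZero s] {X : Matrix (idx L (cubic d s) 0) (idx L (cubic d s) 0) ℂ} {B κ : ℝ} (hκ : 0 ≤ κ) (hB : 0 ≤ B) (hX : EntryDecay (distK L (cubic d s)) X B κ)
    (i j : idx L (cubic d s) 0) : ‖X i j‖ ≤ B :=
  (hX i j).trans (by
    have : Real.exp (-(κ * distK L (cubic d s) i j)) ≤ 1 := by
      rw [Real.exp_le_one_iff, neg_nonpos]; exact mul_nonneg hκ (distK_nonneg L _ _ _)
    simpa using mul_le_mul_of_nonneg_left this hB)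

/-- **`conv_sandwich_of_decay_of_tendsto` — THE GENERIC SANDWICH `S·D·S′` ON `ℤ^d`** [our proof] (`d ≥ 2`, `side t → ∞`, `μ ≠ ν`): three volume-indexed towers on the unit index sets of the
cubic tori with (UD) `EntryDecay distK (S_t k) B_S κ`, `(D_t k) B_D κ`, `(S′_t k) B_S′ κ` and (SR) `TwoLevelDecayRate distK (S_t ·) B_S⁺ κ θ`, `(D_t ·) B_D⁺ κ θ`, `(S′_t ·) B_S′⁺ κ θ` (`κ > 0`,
`0 ≤ θ < 1`, constants `≥ 0` free of `t, k`) and EL₂ of the three ⟹ the β-cell's `LimitRate` END for `S_t k·D_t k·S′_t k`: limit kernels `Π_k`, `UniformDecay`, `StepRate`, `KernelInputs`,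
`|secondMoment (Π k) μ ν − secondMoment Π_∞ μ ν| ≤ β′_d(B′∕(1−θ), κ∕4∕d)·θ^k` (two product steps of PART 130 at rates `κ ↦ κ∕2 ↦ κ∕4` with PART 127's letters; EL at the origin pairs by
PART 142 §3 twice — `S` decays on the left, then `S′` on the right). [cite: Balaban1987RG1, (1.21)–(1.22) p.264 (shapes)] -/
theorem conv_sandwich_of_decay_of_tendsto (hd : 2 ≤ d) (hside : Tendsto side atTop atTop)
    {S D S' : (t : ℕ) → ℕ → Matrix (idx L (cubic d (side t)) 0) (idx L (cubic d (side t)) 0) ℂ} {BS BS' BD BD' BT BT' κ θ : ℝ}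
    (hκ : 0 < κ) (hθ0 : 0 ≤ θ) (hθ1 : θ < 1) (hBS : 0 ≤ BS) (hBS' : 0 ≤ BS') (hBD : 0 ≤ BD) (hBD' : 0 ≤ BD') (hBT : 0 ≤ BT) (hBT' : 0 ≤ BT')
    (hSud : ∀ t k, EntryDecay (distK L (cubic d (side t))) (S t k) BS κ) (hSsr : ∀ t, TwoLevelDecayRate (distK L (cubic d (side t))) (S t) BS' κ θ)
    (hDud : ∀ t k, EntryDecay (distK L (cubic d (side t))) (D t k) BD κ) (hDsr : ∀ t, TwoLevelDecayRate (distK L (cubic d (side t))) (D t) BD' κ θ)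
    (hTud : ∀ t k, EntryDecay (distK L (cubic d (side t))) (S' t k) BT κ) (hTsr : ∀ t, TwoLevelDecayRate (distK L (cubic d (side t))) (S' t) BT' κ θ)
    (hSel : ∀ k μ ν (z z' : Fin d → ℤ), ∃ s' : ℂ, Tendsto (fun t => S t k ((unitIdx L (cubic d (side t))).symm (castT (cubic d (side t)) z, μ))
      ((unitIdx L (cubic d (side t))).symm (castT (cubic d (side t)) z', ν))) atTop (𝓝 s'))
    (hDel : ∀ k μ ν (z z' : Fin d → ℤ), ∃ s' : ℂ, Tendsto (fun t => D t k ((unitIdx L (cubic d (side t))).symm (castT (cubic d (side t)) z, μ))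
      ((unitIdx L (cubic d (side t))).symm (castT (cubic d (side t)) z', ν))) atTop (𝓝 s'))
    (hTel : ∀ k μ ν (z z' : Fin d → ℤ), ∃ s' : ℂ, Tendsto (fun t => S' t k ((unitIdx L (cubic d (side t))).symm (castT (cubic d (side t)) z, μ))
      ((unitIdx L (cubic d (side t))).symm (castT (cubic d (side t)) z', ν))) atTop (𝓝 s'))
    {μ ν : Fin d} (hne : μ ≠ ν) :
    ∃ B B' : ℝ, 0 ≤ B ∧ 0 ≤ B' ∧ ∃ Pinf : ℕ → B12Beta.Kernel d,
      (∀ k, IsInfiniteVolumeLimit side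
        (fun t μ' ν' (z : Site d (side t)) => ((S t k * D t k * S' t k) ((unitIdx L (cubic d (side t))).symm (z, μ')) ((unitIdx L (cubic d (side t))).symm (0, ν'))).re) (Pinf k)) ∧
      Beta.LimitRate.UniformDecay Pinf μ ν B (κ / 2 / 2 / d) ∧ StepRate Pinf μ ν B' (κ / 2 / 2 / d) θ ∧
      (∃ K : KernelInputs d Pinf, K.θ = θ ∧ K.c₀ = betaPrime510 d (B' / (1 - θ)) (κ / 2 / 2 / d) ∧ K.Pinf = limKernelOf Pinf ∧ K.μ = μ ∧ K.ν = ν) ∧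
      (∀ k, |B12Beta.secondMoment (Pinf k) μ ν - B12Beta.secondMoment (limKernelOf Pinf) μ ν| ≤ betaPrime510 d (B' / (1 - θ)) (κ / 2 / 2 / d) * θ ^ k) := by
  have hd1 : 1 ≤ d := le_trans (by norm_num) hd
  have hd0 : (0 : ℝ) < d := by exact_mod_cast lt_of_lt_of_le zero_lt_one hd1
  obtain ⟨S₁, hS₁0, hS₁⟩ := sum_exp_distK_le (d := d) hd (half_pos hκ)
  obtain ⟨S₂, hS₂0, hS₂⟩ := sum_exp_distK_le (d := d) hd (half_pos (half_pos hκ))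
  -- first product `S·D` at rate κ/2
  have hPud : ∀ t k, EntryDecay (distK L (cubic d (side t))) (S t k * D t k) (BS * BD * (d * S₁)) (κ / 2) :=
    fun t k => entryDecay_mul_tower (distK_nonneg L (cubic d (side t))) (distK_triangle L (cubic d (side t))) hκ.le (hS₁ L (cubic d (side t))) (hSud t) (hDud t) k
  have hPsr : ∀ t, TwoLevelDecayRate (distK L (cubic d (side t))) (fun k => S t k * D t k) ((BS' * BD + BS * BD') * (d * S₁)) (κ / 2) θ :=
    fun t => twoLevelDecayRate_mul (distK_nonneg L (cubic d (side t))) (distK_triangle L (cubic d (side t))) hκ.le (hS₁ L (cubic d (side t))) (hSud t) (hDud t) (hSsr t) (hDsr t)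
  -- the right factor at the slower rate κ/2, second product at rate κ/4
  have hTud2 : ∀ t k, EntryDecay (distK L (cubic d (side t))) (S' t k) BT (κ / 2) :=
    fun t k => entryDecay_of_le_rate (distK_nonneg L (cubic d (side t))) (hTud t k) hBT (half_le_self hκ.le)
  have hTsr2 : ∀ t, TwoLevelDecayRate (distK L (cubic d (side t))) (S' t) BT' (κ / 2) θ :=
    fun t k => entryDecay_of_le_rate (distK_nonneg L (cubic d (side t))) (hTsr t k) (mul_nonneg hBT' (pow_nonneg hθ0 k)) (half_le_self hκ.le)
  have hud : ∀ t k, EntryDecay (distK L (cubic d (side t))) (S t k * D t k * S' t k) (BS * BD * (d * S₁) * BT * (d * S₂)) (κ / 2 / 2) :=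
    fun t k => entryDecay_mul_tower (distK_nonneg L (cubic d (side t))) (distK_triangle L (cubic d (side t))) (half_pos hκ).le (hS₂ L (cubic d (side t))) (hPud t) (hTud2 t) k
  have hsr : ∀ t, TwoLevelDecayRate (distK L (cubic d (side t))) (fun k => S t k * D t k * S' t k)
      (((BS' * BD + BS * BD') * (d * S₁) * BT + BS * BD * (d * S₁) * BT') * (d * S₂)) (κ / 2 / 2) θ :=
    fun t => twoLevelDecayRate_mul (distK_nonneg L (cubic d (side t))) (distK_triangle L (cubic d (side t))) (half_pos hκ).le (hS₂ L (cubic d (side t)))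
      (hPud t) (hTud2 t) (hPsr t) (hTsr2 t)
  refine ⟨BS * BD * (d * S₁) * BT * (d * S₂), ((BS' * BD + BS * BD') * (d * S₁) * BT + BS * BD * (d * S₁) * BT') * (d * S₂), by positivity, by positivity, ?_⟩
  refine conv_of_decay_of_tendsto L hd1 hside (half_pos (half_pos hκ)) hθ0 hθ1 hud hsr ?_ hne
  -- EL at the origin pairs: EL₂ of `S·D` (left decaying), then of `(S·D)·S′` (right decaying)
  intro k μ' ν' z
  have hSdec : ∀ t (x : Site d (side t)) μ (w : Site d (side t)) l, ‖S t k ((unitIdx L (cubic d (side t))).symm (x, μ)) ((unitIdx L (cubic d (side t))).symm (w, l))‖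
      ≤ BS * Real.exp (-(κ / d) * l1 (windowMap d (side t) (w - x))) := by
    intro t x μ w l
    have h := norm_le_exp_window_of_entryDecay L (side t) hκ.le (hSud t k) x μ w l
    rwa [show x - w = -(w - x) from (neg_sub w x).symm, DiagramVolumeLimitPairs.l1_windowMap_neg] at h
  have hSD := tendsto_mul_entry_pair' L hside (X := fun t => S t k) (Y := fun t => D t k) hSdec (div_pos hκ hd0)
    (fun t w l y ν => norm_le_of_entryDecay L (side t) hκ.le hBD (hDud t k) _ _) (hSel k) (hDel k)
  have hSDb : ∀ t (x : Site d (side t)) μ (w : Site d (side t)) l, ‖(S t k * D t k) ((unitIdx L (cubic d (side t))).symm (x, μ)) ((unitIdx L (cubic d (side t))).symm (w, l))‖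
      ≤ BS * BD * (d * S₁) := fun t x μ w l => norm_le_of_entryDecay L (side t) (half_pos hκ).le (by positivity) (hPud t k) _ _
  have hTdec : ∀ t (w : Site d (side t)) l (y : Site d (side t)) ν, ‖S' t k ((unitIdx L (cubic d (side t))).symm (w, l)) ((unitIdx L (cubic d (side t))).symm (y, ν))‖
      ≤ BT * Real.exp (-(κ / d) * l1 (windowMap d (side t) (w - y))) := fun t w l y ν => norm_le_exp_window_of_entryDecay L (side t) hκ.le (hTud t k) w l y ν
  obtain ⟨s', hs'⟩ := tendsto_mul_entry_pair L hside (X := fun t => S t k * D t k) (Y := fun t => S' t k) hSDb hTdec (div_pos hκ hd0) hSD (hTel k) μ' ν' z 0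
  have e0 : ∀ t, castT (cubic d (side t)) (0 : Fin d → ℤ) = 0 := fun t => by funext i; simp [castT]
  simp only [e0] at hs'
  exact ⟨s', hs'⟩

end Generic

/-! ## §2 The three inputs for the inverse averaged covariance `c_k⁻¹ = Σ_k + a·1` -/

variable (a : ℝ) (ha : 0 < a)

/-- `c_k⁻¹ = Σ_k + a·1`. [folklore] -/
theorem invCov_eq_effForm_add (M : Fin d → ℕ) [∀ μ, NeZero (M μ)] (k : ℕ) :
    (unitCovB L M a ha k)⁻¹ = ((unitCovB L M a ha k)⁻¹ - (a : ℂ) • (1 : Matrix (idx L M 0) (idx L M 0) ℂ)) + (a : ℂ) • (1 : Matrix (idx L M 0) (idx L M 0) ℂ) := by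
  abel

omit [NeZero L] in
/-- EL₂ of the unit kernel: `1(e(ẑ,μ), e(ẑ′,ν))` is eventually the constant `[z = z′]·[μ = ν]`. [folklore] -/
theorem tendsto_one_pair [NeZero L] {side : ℕ → ℕ} [∀ t, NeZero (side t)] (hside : Tendsto side atTop atTop) (μ ν : Fin d) (z z' : Fin d → ℤ) :
    ∃ s' : ℂ, Tendsto (fun t => (1 : Matrix (idx L (cubic d (side t)) 0) (idx L (cubic d (side t)) 0) ℂ)
        ((unitIdx L (cubic d (side t))).symm (castT (cubic d (side t)) z, μ)) ((unitIdx L (cubic d (side t))).symm (castT (cubic d (side t)) z', ν))) atTop (𝓝 s') := by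
  refine ⟨_, (tendsto_one_apply_castT (d := d) hside μ ν (z - z')).congr fun t => ?_⟩
  have e1 : castT (cubic d (side t)) z = castT (cubic d (side t)) (z - z') + castT (cubic d (side t)) z' := by
    rw [sub_eq_add_neg, castT_add, castT_neg, neg_add_cancel_right]
  have key : (castT (cubic d (side t)) (z - z') = 0 ∧ μ = ν) ↔ (castT (cubic d (side t)) z = castT (cubic d (side t)) z' ∧ μ = ν) := by
    rw [e1]; constructor
    · rintro ⟨h, hμ⟩; exact ⟨by rw [h, zero_add], hμ⟩
    · rintro ⟨h, hμ⟩; exact ⟨by simpa using h, hμ⟩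
  simp only [Matrix.one_apply, Equiv.apply_eq_iff_eq, Prod.mk.injEq, key]

/-- **`invCov_inputs` — (UD)+(SR)+EL₂ FOR `k ↦ c_k⁻¹`** (`L ≥ 2`, `d ≥ 3`): `∃ κ > 0, B, B′ ≥ 0` (from `(d, L, a)`) with, on EVERY cubic torus, (UD) `EntryDecay distK (c_k⁻¹) B κ` and (SR)
`TwoLevelDecayRate distK (k ↦ c_k⁻¹) B′ κ (√(L⁻¹))`, and EL₂ of `c_k⁻¹` along the even cubic volumes — from the effective form's (PART 132 `decay_effForm`, PART 140 `tendsto_effForm_entry`) plus the unit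
kernel (`entryDecay_one`, `tendsto_one_pair`). [folklore] -/
theorem invCov_inputs (hL : 2 ≤ L) (hd : 3 ≤ d) :
    ∃ κ B B' : ℝ, 0 < κ ∧ 0 ≤ B ∧ 0 ≤ B' ∧
      (∀ (s : ℕ) [NeZero s] (k : ℕ), EntryDecay (distK L (cubic d s)) (unitCovB L (cubic d s) a ha k)⁻¹ B κ) ∧
      (∀ (s : ℕ) [NeZero s], TwoLevelDecayRate (distK L (cubic d s)) (fun k => (unitCovB L (cubic d s) a ha k)⁻¹) B' κ (Real.sqrt ((L : ℝ)⁻¹))) ∧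
      (∀ k μ ν (z z' : Fin d → ℤ), ∃ s' : ℂ, Tendsto (fun t => (unitCovB L (cubic d (evenPeriod t)) a ha k)⁻¹
        ((unitIdx L (cubic d (evenPeriod t))).symm (castT (cubic d (evenPeriod t)) z, μ)) ((unitIdx L (cubic d (evenPeriod t))).symm (castT (cubic d (evenPeriod t)) z', ν))) atTop (𝓝 s')) := by
  have hd2 : 2 ≤ d := le_trans (by norm_num) hd
  obtain ⟨κ', Bs, Bs', hκ', hBs, hBs', h⟩ := decay_effForm L a ha hL hd2
  refine ⟨κ', Bs + ‖(a : ℂ)‖ * 1, Bs', hκ', by positivity, hBs', fun s _ k => ?_, fun s _ => ?_, fun k μ ν z z' => ?_⟩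
  · rw [invCov_eq_effForm_add L a ha]
    exact entryDecay_add ((h (cubic d s)).1 k) (entryDecay_smul (entryDecay_one (distK_self L (cubic d s)) κ') (a : ℂ))
  · intro k x y
    have e : (unitCovB L (cubic d s) a ha (k + 1))⁻¹ - (unitCovB L (cubic d s) a ha k)⁻¹
        = ((unitCovB L (cubic d s) a ha (k + 1))⁻¹ - (a : ℂ) • (1 : Matrix (idx L (cubic d s) 0) (idx L (cubic d s) 0) ℂ))
          - ((unitCovB L (cubic d s) a ha k)⁻¹ - (a : ℂ) • (1 : Matrix (idx L (cubic d s) 0) (idx L (cubic d s) 0) ℂ)) := by abel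
    rw [e]
    exact (h (cubic d s)).2 k x y
  · obtain ⟨s₁, h₁⟩ := tendsto_effForm_entry L a ha hd k μ ν z z'
    obtain ⟨s₂, h₂⟩ := tendsto_one_pair L (d := d) tendsto_evenPeriod μ ν z z'
    refine ⟨s₁ + (a : ℂ) * s₂, ?_⟩
    have e : ∀ t, (unitCovB L (cubic d (evenPeriod t)) a ha k)⁻¹
        ((unitIdx L (cubic d (evenPeriod t))).symm (castT (cubic d (evenPeriod t)) z, μ)) ((unitIdx L (cubic d (evenPeriod t))).symm (castT (cubic d (evenPeriod t)) z', ν))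
        = ((unitCovB L (cubic d (evenPeriod t)) a ha k)⁻¹ - (a : ℂ) • (1 : Matrix (idx L (cubic d (evenPeriod t)) 0) (idx L (cubic d (evenPeriod t)) 0) ℂ))
            ((unitIdx L (cubic d (evenPeriod t))).symm (castT (cubic d (evenPeriod t)) z, μ)) ((unitIdx L (cubic d (evenPeriod t))).symm (castT (cubic d (evenPeriod t)) z', ν))
          + (a : ℂ) * (1 : Matrix (idx L (cubic d (evenPeriod t)) 0) (idx L (cubic d (evenPeriod t)) 0) ℂ)
            ((unitIdx L (cubic d (evenPeriod t))).symm (castT (cubic d (evenPeriod t)) z, μ)) ((unitIdx L (cubic d (evenPeriod t))).symm (castT (cubic d (evenPeriod t)) z', ν)) := by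
      intro t; rw [Matrix.sub_apply, Matrix.smul_apply, smul_eq_mul]; ring
    simp only [e]
    exact h₁.add (h₂.const_mul (a : ℂ))

/-! ## §3 The u-derivative socket: `c_k⁻¹·X·c_k⁻¹` on `ℤ^d` modulo the insertion -/

/-- **`conv_insertion_invCov_of_kernel` — THE u-DERIVATIVE SOCKET** [our proof] (`d ≥ 3`, `L ≥ 2`, `a > 0`, `μ ≠ ν`, along the even cubic volumes `side t = 2(t+1)`): for ANY volume-indexed
insertion tower `X_t k` on the unit index sets with (UD) `EntryDecay distK (X_t k) B_X κ_X`, (SR) `TwoLevelDecayRate distK (X_t ·) B_X′ κ_X (√(L⁻¹))` (`κ_X > 0`, constants free of `t, k`) and EL₂,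
the tower `c_k⁻¹·X_t k·c_k⁻¹` — the shape of PART 128's `Σ̇_k = −c_k⁻¹ċ_kc_k⁻¹` and of PART 129's perturbed effective forms — has limit kernels `Π_k` (`IsInfiniteVolumeLimit`), `UniformDecay`,
`StepRate (√(L⁻¹))`, `KernelInputs d Π` and `|secondMoment (Π k) μ ν − secondMoment Π_∞ μ ν| ≤ c₀(√(L⁻¹))^k`, with rate and constants from `(d, L, a, B_X, B_X′, κ_X)`.  The insertion is the ONLY
displayed input. [cite: Balaban1987RG1, (1.21)–(1.22) p.264 (shapes)] -/
theorem conv_insertion_invCov_of_kernel (hL : 2 ≤ L) (hd : 3 ≤ d) {μ ν : Fin d} (hne : μ ≠ ν)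
    {X : (t : ℕ) → ℕ → Matrix (idx L (cubic d (evenPeriod t)) 0) (idx L (cubic d (evenPeriod t)) 0) ℂ} {BX BX' κX : ℝ} (hκX : 0 < κX) (hBX : 0 ≤ BX) (hBX' : 0 ≤ BX')
    (hXud : ∀ t k, EntryDecay (distK L (cubic d (evenPeriod t))) (X t k) BX κX)
    (hXsr : ∀ t, TwoLevelDecayRate (distK L (cubic d (evenPeriod t))) (X t) BX' κX (Real.sqrt ((L : ℝ)⁻¹)))
    (hXel : ∀ k μ ν (z z' : Fin d → ℤ), ∃ s' : ℂ, Tendsto (fun t => X t k ((unitIdx L (cubic d (evenPeriod t))).symm (castT (cubic d (evenPeriod t)) z, μ))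
      ((unitIdx L (cubic d (evenPeriod t))).symm (castT (cubic d (evenPeriod t)) z', ν))) atTop (𝓝 s')) :
    ∃ κ B B' : ℝ, 0 < κ ∧ 0 ≤ B ∧ 0 ≤ B' ∧ ∃ Pinf : ℕ → B12Beta.Kernel d,
      (∀ k, IsInfiniteVolumeLimit evenPeriod
        (fun t μ' ν' (z : Site d (evenPeriod t)) => (((unitCovB L (cubic d (evenPeriod t)) a ha k)⁻¹ * X t k * (unitCovB L (cubic d (evenPeriod t)) a ha k)⁻¹)
          ((unitIdx L (cubic d (evenPeriod t))).symm (z, μ')) ((unitIdx L (cubic d (evenPeriod t))).symm (0, ν'))).re) (Pinf k)) ∧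
      Beta.LimitRate.UniformDecay Pinf μ ν B (κ / d) ∧ StepRate Pinf μ ν B' (κ / d) (Real.sqrt ((L : ℝ)⁻¹)) ∧
      (∃ K : KernelInputs d Pinf, K.θ = Real.sqrt ((L : ℝ)⁻¹) ∧ K.c₀ = betaPrime510 d (B' / (1 - Real.sqrt ((L : ℝ)⁻¹))) (κ / d) ∧ K.Pinf = limKernelOf Pinf ∧ K.μ = μ ∧ K.ν = ν) ∧
      (∀ k, |B12Beta.secondMoment (Pinf k) μ ν - B12Beta.secondMoment (limKernelOf Pinf) μ ν|
          ≤ betaPrime510 d (B' / (1 - Real.sqrt ((L : ℝ)⁻¹))) (κ / d) * Real.sqrt ((L : ℝ)⁻¹) ^ k) := by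
  have hd2 : 2 ≤ d := le_trans (by norm_num) hd
  obtain ⟨κc, Bc, Bc', hκc, hBc, hBc', hcud, hcsr, hcel⟩ := invCov_inputs L a ha hL hd
  have hL1 : (1 : ℝ) < L := by exact_mod_cast (lt_of_lt_of_le one_lt_two hL : 1 < L)
  have hθ0 : 0 ≤ Real.sqrt ((L : ℝ)⁻¹) := Real.sqrt_nonneg _
  have hθ1 : Real.sqrt ((L : ℝ)⁻¹) < 1 := by
    rw [show (1 : ℝ) = Real.sqrt 1 from Real.sqrt_one.symm]
    exact Real.sqrt_lt_sqrt (inv_nonneg.mpr (Nat.cast_nonneg _)) (inv_lt_one_of_one_lt₀ hL1)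
  -- common rate
  set κ₀ : ℝ := min κc κX with hκ₀
  have hκ₀0 : 0 < κ₀ := lt_min hκc hκX
  have hcud' : ∀ t k, EntryDecay (distK L (cubic d (evenPeriod t))) (unitCovB L (cubic d (evenPeriod t)) a ha k)⁻¹ Bc κ₀ :=
    fun t k => entryDecay_of_le_rate (distK_nonneg L _) (hcud (evenPeriod t) k) hBc (min_le_left _ _)
  have hcsr' : ∀ t, TwoLevelDecayRate (distK L (cubic d (evenPeriod t))) (fun k => (unitCovB L (cubic d (evenPeriod t)) a ha k)⁻¹) Bc' κ₀ (Real.sqrt ((L : ℝ)⁻¹)) :=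
    fun t k => entryDecay_of_le_rate (distK_nonneg L _) (hcsr (evenPeriod t) k) (mul_nonneg hBc' (pow_nonneg hθ0 k)) (min_le_left _ _)
  have hXud' : ∀ t k, EntryDecay (distK L (cubic d (evenPeriod t))) (X t k) BX κ₀ :=
    fun t k => entryDecay_of_le_rate (distK_nonneg L _) (hXud t k) hBX (min_le_right _ _)
  have hXsr' : ∀ t, TwoLevelDecayRate (distK L (cubic d (evenPeriod t))) (X t) BX' κ₀ (Real.sqrt ((L : ℝ)⁻¹)) :=
    fun t k => entryDecay_of_le_rate (distK_nonneg L _) (hXsr t k) (mul_nonneg hBX' (pow_nonneg hθ0 k)) (min_le_right _ _)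
  obtain ⟨B, B', hB, hB', h⟩ := conv_sandwich_of_decay_of_tendsto L hd2 tendsto_evenPeriod (S := fun t k => (unitCovB L (cubic d (evenPeriod t)) a ha k)⁻¹) (D := X)
    (S' := fun t k => (unitCovB L (cubic d (evenPeriod t)) a ha k)⁻¹) hκ₀0 hθ0 hθ1 hBc hBc' hBX hBX' hBc hBc'
    hcud' hcsr' hXud' hXsr' hcud' hcsr' hcel hXel hcel hne
  exact ⟨κ₀ / 2 / 2, B, B', half_pos (half_pos hκ₀0), hB, hB', h⟩

end Summit.QuantumFields.BalabanUV.Beta.GAN24.DiagramVolumeLimitSandwich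

end
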